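import Summits.QuantumFields.YangMills.Theorems.BalabanUVNodesN15KingModelCycleResolventReadings
import HarnessLib

/-!
# BalabanUVNodes ∕ N15 — THE KING-MODEL RUNG (PART Ϲ-g): KING's «MULTIPLE REFLECTION REPRESENTATION» IN ONE DIMENSION — THE FREE-BOUNDARY (box)
# MASSIVE PATH RESOLVENT IS THE EVEN IMAGE SUM OF THE TORUS RESOLVENT OF THE DOUBLED PERIOD:
# `(x + (−Δ_free))⁻¹(s,t) = G^{torus}_{2n}(s − t) + G^{torus}_{2n}(s + t + 1) = cosh(ω(min+½))·cosh(ω(n−½−max)) ∕ (sinh ω · sinh(ωn))`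
# (Track A, DAG node N15 = NE2; FAN-OUT v1.1 §N15 s3 «KING-MODEL RUNG» — its named alternative currency «torus-vs-box twin», in the time direction; count-neutral)

HONEST FRAMING.  Count-neutral (cell `pub-ymgap`, seat `pub-ymgap-dag-n15-e` g38; `--supports stmt-QuantumFields-27366 --as helper` = K3⁸).
TEMPLATE LITERATURE: C. King, Commun. Math. Phys. **102** (1986) 649–677 [King1986] §4 p.670: King's regions are rectangular boxes `Ω` with FREE
boundary conditions («with free boundary conditions (and A = 0, of course)»), and the torus (periodic) estimates are transported to them «by using
multiple reflection representations … given explicitly in [Ba 4]» — the tree's `King1986/EffectiveLaplacianSymbol` records this step as NOT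
formalised.  THIS FILE formalises its simplest instance, the `d = 1` (time-direction) factor: the massive second-difference operator with FREE
(Neumann) ends on the box `{0,…,n−1}` — quadratic form `x·Σ_s f(s)² + Σ_{bonds}(f(s+1) − f(s))²`, stencil `x + #neighbours` on the diagonal — is
inverted in CLOSED FORM by the METHOD OF IMAGES: fold the cycle `ℤ∕2n` by the reflection `z ↦ −1 − z` (fixed «points» = the two half-bonds at the
ends of the box); an even function on the doubled cycle restricted to the box satisfies the free-boundary stencil (§3), so the box resolvent is
PART Ϲ-a's torus resolvent of period `2n` plus its mirror image (§4), with the closed form `cosh(ω(min+½))cosh(ω(n−½−max))∕(sinh ω sinh(ωn))` (§5)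
— the same lattice mass `ω = latticeMass x` as on the torus (the gap does not depend on the boundary condition; only the images do).
Montvay–Münster [MontvayMunster1994] §2.1.2∕§2.2.1 for the transfer-matrix vocabulary.  NOT Bałaban's covariant objects; NOT a node discharge
(N15 is booked through n15-a's knit, untouched); King's `d+1`-dimensional transport is NOT formalised beyond this factor; nothing continuum-YM ∕
ℝ⁴ ∕ OS axioms ∕ Clay.  0 `sorry`.

OBJECTS.  `pathOp n x : Matrix (Fin n) (Fin n) ℝ` (free-boundary stencil), `dbl n : Fin n → ZMod (2n)` (`s ↦ s`), `mirror n : Fin n → ZMod (2n)`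
(`s ↦ −1 − s`, i.e. `2n − 1 − s`), `pathGreen n x s t := cycleGreen (2n) x (dbl s − dbl t) + cycleGreen (2n) x (dbl s − mirror t)`.

WHAT THIS FILE PROVES (kernel).  §1 ★ `pathOp_mulVec_apply` (`((x + (−Δ_free))f)(s) = x f(s) + Σ_{s′ ∼ s}(f(s) − f(s′))`).  §2 doubling letters
(`dbl_add_one`, `dbl_sub_one`, `dbl_add_one_of_last`, `dbl_sub_one_of_first`, `mirror_sub_dbl`, `mirror_sub_mirror`, `dbl_sub_mirror`, `dbl_ne_mirror`,
`dbl_injective`).  §3 ★★ **`cycleOp_mulVec_even`** (THE REFLECTION PRINCIPLE: for an even function `F` on `ℤ∕2n` — `F(dbl s) = F(mirror s) = f(s)` —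
`((2+x) − S − S⁻¹)F` at `dbl s` equals `(x + (−Δ_free))f` at `s`).  §4 ★★ `pathOp_mulVec_pathGreen`, ★★ `pathOp_mul_greenMatrix`, `isUnit_pathOp`,
★★★ **`pathOp_inv_apply`** (THE METHOD OF IMAGES: `(x + (−Δ_free))⁻¹(s,t) = G^{torus}_{2n}(s − t) + G^{torus}_{2n}(s + t + 1)`), `pathGreen_symm`,
`pathGreen_pos`.  §5 ★★ **`pathGreen_eq_cosh_add`** (`= (cosh(ω(n − |s−t|)) + cosh(ω(n − 1 − s − t)))∕(2 sinh ω sinh(ωn))`), ★★ **`pathGreen_eq_cosh_mul_cosh`**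
(`= cosh(ω(min(s,t)+½))·cosh(ω(n−½−max(s,t)))∕(sinh ω sinh(ωn))`).

HONEST SCOPE.  One dimension; `x > 0`; free (Neumann) ends only (Dirichlet ends would be the ODD image sum — not treated).  The torus-vs-box and
box-vs-line comparisons are in the companion `…KingModelTorusBoxTwin`.  N15 untouched; counts unmoved.
Locators: [King1986] §4 p.670 («free boundary conditions», «multiple reflection representations»), (4.4) p.670; [MontvayMunster1994] §2.1.2 (2.49), §2.2.1 (2.74)–(2.76).
-/

noncomputable section

open scoped BigOperators
open Finset Matrix Real

namespace Summit.QuantumFields.YangMills.BalabanUVNodes.N15KingModelRung.TorusSpectral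

variable (n : ℕ) [NeZero n]

/-! ## §1 The free-boundary stencil on the box `{0,…,n−1}` -/

section Stencil

/-- KING's FREE-BOUNDARY MASSIVE SECOND-DIFFERENCE OPERATOR on the box `{0,…,n−1}`: `(s,t) ↦ x[t=s] + Σ_{bonds at s}([t=s] − [t = other end])` —
the operator of the quadratic form `x·Σf² + Σ_{bonds}(f(s+1) − f(s))²` (no term for the missing neighbours of the two end points: free ∕ Neumann
boundary conditions). [cite: King1986, (4.4) p.670] -/
def pathOp (x : ℝ) : Matrix (Fin n) (Fin n) ℝ := fun s t =>
  x * (if t = s then 1 else 0)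
    + (if s.val + 1 < n then ((if t = s then (1 : ℝ) else 0) - (if t.val = s.val + 1 then 1 else 0)) else 0)
    + (if 0 < s.val then ((if t = s then (1 : ℝ) else 0) - (if t.val + 1 = s.val then 1 else 0)) else 0)

omit [NeZero n] in
/-- ★ THE FREE-BOUNDARY STENCIL: `((x + (−Δ_free))f)(s) = x·f(s) + [s+1 < n](f(s) − f(s+1)) + [0 < s](f(s) − f(s−1))`. [cite: King1986, (4.4) p.670] -/
theorem pathOp_mulVec_apply (x : ℝ) (f : Fin n → ℝ) (s : Fin n) :
    (pathOp n x *ᵥ f) s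
      = x * f s + (if h : s.val + 1 < n then f s - f ⟨s.val + 1, h⟩ else 0)
          + (if h : 0 < s.val then f s - f ⟨s.val - 1, by omega⟩ else 0) := by
  simp only [Matrix.mulVec, dotProduct, pathOp]
  simp_rw [add_mul, Finset.sum_add_distrib]
  have h1 : ∑ t : Fin n, x * (if t = s then (1 : ℝ) else 0) * f t = x * f s := by
    simp_rw [mul_assoc, ite_mul, one_mul, zero_mul, ← Finset.mul_sum]
    rw [Finset.sum_ite_eq' Finset.univ s]; simp
  have h2 : ∑ t : Fin n, (if s.val + 1 < n then ((if t = s then (1 : ℝ) else 0) - (if t.val = s.val + 1 then 1 else 0)) else 0) * f t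
      = (if h : s.val + 1 < n then f s - f ⟨s.val + 1, h⟩ else 0) := by
    by_cases h : s.val + 1 < n
    · simp only [h, if_true, dif_pos]
      have : ∀ t : Fin n, (t.val = s.val + 1) ↔ (t = ⟨s.val + 1, h⟩) := fun t => by rw [Fin.ext_iff]
      simp_rw [this, sub_mul, ite_mul, one_mul, zero_mul, Finset.sum_sub_distrib, Finset.sum_ite_eq', Finset.mem_univ, if_true]
    · simp [h]
  have h3 : ∑ t : Fin n, (if 0 < s.val then ((if t = s then (1 : ℝ) else 0) - (if t.val + 1 = s.val then 1 else 0)) else 0) * f t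
      = (if h : 0 < s.val then f s - f ⟨s.val - 1, by omega⟩ else 0) := by
    by_cases h : 0 < s.val
    · simp only [h, if_true, dif_pos]
      have : ∀ t : Fin n, (t.val + 1 = s.val) ↔ (t = ⟨s.val - 1, by omega⟩) := fun t => by rw [Fin.ext_iff]; simp only; omega
      simp_rw [this, sub_mul, ite_mul, one_mul, zero_mul, Finset.sum_sub_distrib, Finset.sum_ite_eq', Finset.mem_univ, if_true]
    · simp [h]
  rw [h1, h2, h3]

end Stencil

/-! ## §2 The doubling: the box inside the cycle `ℤ∕2n` and its mirror image -/

section Doubling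

/-- The box point `s` read in the doubled cycle `ℤ∕2n`. [folklore] -/
def dbl (s : Fin n) : ZMod (2 * n) := ((s.val : ℕ) : ZMod (2 * n))

/-- The mirror image `−1 − s` (`= 2n − 1 − s`) of the box point `s` in the doubled cycle: the reflection across the half-bonds at the two ends of
the box. [cite: King1986, §4 p.670] -/
def mirror (s : Fin n) : ZMod (2 * n) := -1 - ((s.val : ℕ) : ZMod (2 * n))

omit [NeZero n] in
/-- Interior successor: `dbl s + 1 = dbl (s+1)`. [folklore] -/
theorem dbl_add_one {s : Fin n} (h : s.val + 1 < n) : dbl n s + 1 = dbl n ⟨s.val + 1, h⟩ := by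
  simp [dbl]

omit [NeZero n] in
/-- Interior predecessor: `dbl s − 1 = dbl (s−1)`. [folklore] -/
theorem dbl_sub_one {s : Fin n} (h : 0 < s.val) : dbl n s - 1 = dbl n ⟨s.val - 1, by omega⟩ := by
  simp only [dbl]
  rw [sub_eq_iff_eq_add]
  norm_cast
  congr 1; omega

omit [NeZero n] in
/-- At the right end the successor is the mirror image: `dbl (n−1) + 1 = mirror (n−1)` (`= n`). [folklore] -/
theorem dbl_add_one_of_last {s : Fin n} (h : s.val + 1 = n) : dbl n s + 1 = mirror n s := by
  simp only [dbl, mirror]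
  have h2n : ((2 * n : ℕ) : ZMod (2 * n)) = 0 := ZMod.natCast_self _
  have : ((s.val : ℕ) : ZMod (2 * n)) = (n : ZMod (2 * n)) - 1 := by
    rw [eq_sub_iff_add_eq]; norm_cast; rw [h]
  rw [this]
  have hn : ((n : ℕ) : ZMod (2 * n)) + n = 0 := by rw [← h2n]; push_cast; ring
  linear_combination hn

omit [NeZero n] in
/-- At the left end the predecessor is the mirror image: `dbl 0 − 1 = mirror 0` (`= −1`). [folklore] -/
theorem dbl_sub_one_of_first {s : Fin n} (h : s.val = 0) : dbl n s - 1 = mirror n s := by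
  simp [dbl, mirror, h]

omit [NeZero n] in
/-- `mirror s − dbl t = −(dbl s − mirror t)`. [folklore] -/
theorem mirror_sub_dbl (s t : Fin n) : mirror n s - dbl n t = -(dbl n s - mirror n t) := by
  simp only [mirror, dbl]; ring

omit [NeZero n] in
/-- `mirror s − mirror t = −(dbl s − dbl t)`. [folklore] -/
theorem mirror_sub_mirror (s t : Fin n) : mirror n s - mirror n t = -(dbl n s - dbl n t) := by
  simp only [mirror, dbl]; ring

omit [NeZero n] in
/-- `dbl s − mirror t = s + t + 1` in `ℤ∕2n`. [folklore] -/
theorem dbl_sub_mirror (s t : Fin n) : dbl n s - mirror n t = ((s.val + t.val + 1 : ℕ) : ZMod (2 * n)) := by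
  simp only [dbl, mirror]; push_cast; ring

omit [NeZero n] in
/-- `val(dbl s − mirror t) = s + t + 1` (no wrap: `s + t + 1 ≤ 2n − 1`). [folklore] -/
theorem val_dbl_sub_mirror (s t : Fin n) : (dbl n s - mirror n t).val = s.val + t.val + 1 := by
  rw [dbl_sub_mirror, ZMod.val_cast_of_lt (by omega)]

omit [NeZero n] in
/-- A box point is never the mirror image of a box point (`s + t + 1 ≢ 0 mod 2n`). [folklore] -/
theorem dbl_ne_mirror (s t : Fin n) : dbl n s ≠ mirror n t := by
  intro h
  have h0 : dbl n s - mirror n t = 0 := sub_eq_zero.mpr h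
  have hv := congrArg ZMod.val h0
  rw [val_dbl_sub_mirror, ZMod.val_zero] at hv
  omega

omit [NeZero n] in
/-- `val(dbl s − dbl t) = s − t` for `t ≤ s`. [folklore] -/
theorem val_dbl_sub_dbl {s t : Fin n} (hts : t.val ≤ s.val) : (dbl n s - dbl n t).val = s.val - t.val := by
  simp only [dbl]
  rw [← Nat.cast_sub hts, ZMod.val_cast_of_lt (by omega)]

omit [NeZero n] in
/-- `dbl` is injective. [folklore] -/
theorem dbl_injective : Function.Injective (dbl n) := by
  intro s t h
  have hs := congrArg ZMod.val h
  simp only [dbl, ZMod.val_cast_of_lt (show s.val < 2 * n by omega), ZMod.val_cast_of_lt (show t.val < 2 * n by omega)] at hs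
  exact Fin.ext hs

end Doubling

/-! ## §3 The reflection principle: an even function on the doubled cycle satisfies the free-boundary stencil on the box -/

section Reflection

/-- ★★ **THE REFLECTION PRINCIPLE**: if `F` on `ℤ∕2n` is the even extension of `f` on the box (`F(dbl s) = F(mirror s) = f(s)`), then
`(((2+x) − S − S⁻¹)F)(dbl s) = ((x + (−Δ_free))f)(s)` — at an end point the missing neighbour of the box is the mirror image of the end point
itself, so the torus stencil collapses to the free-boundary one. [cite: King1986, §4 p.670] -/
theorem cycleOp_mulVec_even (x : ℝ) (F : ZMod (2 * n) → ℝ) (f : Fin n → ℝ) (hF : ∀ s, F (dbl n s) = f s) (hF' : ∀ s, F (mirror n s) = f s)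
    (s : Fin n) : (cycleOp (2 * n) x *ᵥ F) (dbl n s) = (pathOp n x *ᵥ f) s := by
  rw [cycleOp_mulVec_apply, pathOp_mulVec_apply, hF]
  have hplus : F (dbl n s + 1) = (if h : s.val + 1 < n then f ⟨s.val + 1, h⟩ else f s) := by
    by_cases h : s.val + 1 < n
    · rw [dif_pos h, dbl_add_one n h, hF]
    · rw [dif_neg h, dbl_add_one_of_last n (by omega), hF']
  have hminus : F (dbl n s - 1) = (if h : 0 < s.val then f ⟨s.val - 1, by omega⟩ else f s) := by
    by_cases h : 0 < s.val
    · rw [dif_pos h, dbl_sub_one n h, hF]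
    · rw [dif_neg h, dbl_sub_one_of_first n (by omega), hF']
  rw [hplus, hminus]
  by_cases h1 : s.val + 1 < n <;> by_cases h2 : 0 < s.val <;> simp only [h1, h2, dif_pos, dif_neg, not_false_eq_true] <;> ring

end Reflection

/-! ## §4 The method of images: the box resolvent is the torus resolvent of the doubled period plus its mirror image -/

section Images

/-- THE BOX GREEN's FUNCTION by images: `G^{box}(s,t) = G^{torus}_{2n}(s − t) + G^{torus}_{2n}(s − mirror t)`. [cite: King1986, §4 p.670] -/
def pathGreen (x : ℝ) (s t : Fin n) : ℝ :=
  cycleGreen (2 * n) x (dbl n s - dbl n t) + cycleGreen (2 * n) x (dbl n s - mirror n t)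

/-- ★★ The image sum inverts the free-boundary operator, column by column: `(x + (−Δ_free))·G^{box}(·,t) = δ_t` (`x > 0`). [cite: King1986, §4 p.670] -/
theorem pathOp_mulVec_pathGreen {x : ℝ} (hx : 0 < x) (t : Fin n) :
    pathOp n x *ᵥ (fun s => pathGreen n x s t) = Pi.single t (1 : ℝ) := by
  funext s
  let F : ZMod (2 * n) → ℝ := fun z => cycleGreen (2 * n) x (z - dbl n t) + cycleGreen (2 * n) x (z - mirror n t)
  have hF : ∀ s', F (dbl n s') = pathGreen n x s' t := fun s' => rfl
  have hF' : ∀ s', F (mirror n s') = pathGreen n x s' t := by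
    intro s'
    show cycleGreen (2 * n) x (mirror n s' - dbl n t) + cycleGreen (2 * n) x (mirror n s' - mirror n t) = _
    rw [mirror_sub_dbl, mirror_sub_mirror, cycleGreen_neg, cycleGreen_neg, add_comm]
    rfl
  rw [← cycleOp_mulVec_even n x F (fun s' => pathGreen n x s' t) hF hF' s]
  have hsplit : F = (fun z => cycleGreen (2 * n) x (z - dbl n t)) + (fun z => cycleGreen (2 * n) x (z - mirror n t)) := rfl
  rw [hsplit, Matrix.mulVec_add, Pi.add_apply, cycleOp_mulVec_cycleGreen_sub (2 * n) hx, cycleOp_mulVec_cycleGreen_sub (2 * n) hx,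
    Pi.single_eq_of_ne (dbl_ne_mirror n s t), add_zero]
  by_cases hst : s = t
  · subst hst; rw [Pi.single_eq_same, Pi.single_eq_same]
  · rw [Pi.single_eq_of_ne hst, Pi.single_eq_of_ne (fun h => hst (dbl_injective n h))]

/-- ★★ `A·G = 1` for the free-boundary operator and the image-sum matrix. [cite: King1986, §4 p.670] -/
theorem pathOp_mul_greenMatrix {x : ℝ} (hx : 0 < x) :
    pathOp n x * (Matrix.of fun s t => pathGreen n x s t) = 1 := by
  ext s t
  have h := congr_fun (pathOp_mulVec_pathGreen n hx t) s
  rw [Matrix.mulVec, dotProduct] at h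
  rw [Matrix.mul_apply, Matrix.one_apply, ← Pi.single_apply t (1 : ℝ) s, ← h]
  rfl

/-- The free-boundary operator is invertible (`x > 0`). [folklore] -/
theorem isUnit_pathOp {x : ℝ} (hx : 0 < x) : IsUnit (pathOp n x) :=
  IsUnit.of_mul_eq_one _ (pathOp_mul_greenMatrix n hx)

/-- ★★★ **THE METHOD OF IMAGES (King's multiple reflection representation, `d = 1`)**: the resolvent of the FREE-BOUNDARY massive operator on the
box `{0,…,n−1}` is the torus resolvent of the doubled period plus its mirror image,
`(x + (−Δ_free))⁻¹(s,t) = G^{torus}_{2n}(s − t) + G^{torus}_{2n}(s + t + 1)`, every `n ≥ 1`, `x > 0`. [cite: King1986, §4 p.670] -/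
theorem pathOp_inv_apply {x : ℝ} (hx : 0 < x) (s t : Fin n) : (pathOp n x)⁻¹ s t = pathGreen n x s t := by
  rw [Matrix.inv_eq_right_inv (pathOp_mul_greenMatrix n hx), Matrix.of_apply]

/-- The box Green's function is STRICTLY POSITIVE (`x > 0`). [folklore] -/
theorem pathGreen_pos {x : ℝ} (hx : 0 < x) (s t : Fin n) : 0 < pathGreen n x s t :=
  add_pos (cycleGreen_pos (2 * n) hx _) (cycleGreen_pos (2 * n) hx _)

/-- The box Green's function is symmetric. [folklore] -/
theorem pathGreen_symm (x : ℝ) (s t : Fin n) : pathGreen n x t s = pathGreen n x s t := by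
  unfold pathGreen
  rw [show dbl n t - dbl n s = -(dbl n s - dbl n t) by ring, cycleGreen_neg,
    show dbl n t - mirror n s = dbl n s - mirror n t by simp only [dbl, mirror]; ring]

end Images

/-! ## §5 The closed forms -/

section ClosedForm

/-- ★★ **CLOSED FORM (sum)**: `G^{box}(s,t) = (cosh(ω(n − |s−t|)) + cosh(ω(n − 1 − s − t))) ∕ (2 sinh ω · sinh(ωn))`. [cite: King1986, §4 p.670; MontvayMunster1994, §2.2.1 (2.74)–(2.76)] -/
theorem pathGreen_eq_cosh_add (x : ℝ) (s t : Fin n) :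
    pathGreen n x s t
      = (Real.cosh (latticeMass x * (n - ((max s.val t.val : ℕ) - (min s.val t.val : ℕ) : ℝ)))
          + Real.cosh (latticeMass x * (n - 1 - s.val - t.val)))
        / (2 * Real.sinh (latticeMass x) * Real.sinh (latticeMass x * n)) := by
  have hper : latticeMass x * ((2 * n : ℕ) : ℝ) / 2 = latticeMass x * n := by push_cast; ring
  have hhalf : (((2 * n : ℕ) : ℝ)) / 2 = n := by push_cast; ring
  -- the mirror term
  have h2 : cycleGreen (2 * n) x (dbl n s - mirror n t)
      = Real.cosh (latticeMass x * (n - 1 - s.val - t.val)) / (2 * Real.sinh (latticeMass x) * Real.sinh (latticeMass x * n)) := by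
    unfold cycleGreen cycleProfile
    rw [val_dbl_sub_mirror, hper, hhalf, ← Real.cosh_neg]
    congr 2; push_cast; ring
  -- the direct term, by cases on the order of `s`, `t`
  have h1 : cycleGreen (2 * n) x (dbl n s - dbl n t)
      = Real.cosh (latticeMass x * (n - ((max s.val t.val : ℕ) - (min s.val t.val : ℕ) : ℝ)))
          / (2 * Real.sinh (latticeMass x) * Real.sinh (latticeMass x * n)) := by
    rcases le_total t.val s.val with hts | hst
    · unfold cycleGreen cycleProfile
      rw [val_dbl_sub_dbl n hts, hper, hhalf, max_eq_left hts, min_eq_right hts, Nat.cast_sub hts, ← Real.cosh_neg]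
      congr 2; ring
    · rw [show dbl n s - dbl n t = -(dbl n t - dbl n s) by ring, cycleGreen_neg]
      unfold cycleGreen cycleProfile
      rw [val_dbl_sub_dbl n hst, hper, hhalf, max_eq_right hst, min_eq_left hst, Nat.cast_sub hst, ← Real.cosh_neg]
      congr 2; ring
  unfold pathGreen
  rw [h1, h2, ← add_div]

/-- ★★ **CLOSED FORM (product)**: `G^{box}(s,t) = cosh(ω(min(s,t) + ½))·cosh(ω(n − ½ − max(s,t))) ∕ (sinh ω · sinh(ωn))` — the textbook Neumann
Green's function of the massive chain. [cite: King1986, §4 p.670; MontvayMunster1994, §2.2.1 (2.74)–(2.76)] -/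
theorem pathGreen_eq_cosh_mul_cosh (x : ℝ) (s t : Fin n) :
    pathGreen n x s t
      = Real.cosh (latticeMass x * ((min s.val t.val : ℕ) + 1 / 2)) * Real.cosh (latticeMass x * (n - 1 / 2 - (max s.val t.val : ℕ)))
        / (Real.sinh (latticeMass x) * Real.sinh (latticeMass x * n)) := by
  rw [pathGreen_eq_cosh_add]
  have hsum : (min s.val t.val : ℕ) + (max s.val t.val : ℕ) = s.val + t.val := min_add_max _ _
  have hst : ((s.val : ℝ) + t.val) = ((min s.val t.val : ℕ) : ℝ) + ((max s.val t.val : ℕ) : ℝ) := by exact_mod_cast hsum.symm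
  -- `cosh A cosh B = (cosh(A+B) + cosh(A−B))∕2`
  set ω := latticeMass x
  set lo : ℝ := ((min s.val t.val : ℕ) : ℝ)
  set hi : ℝ := ((max s.val t.val : ℕ) : ℝ)
  have hprod : Real.cosh (ω * (lo + 1 / 2)) * Real.cosh (ω * (n - 1 / 2 - hi))
      = (Real.cosh (ω * (n - (hi - lo))) + Real.cosh (ω * (n - 1 - s.val - t.val))) / 2 := by
    have e1 : ω * (n - (hi - lo)) = ω * (lo + 1 / 2) + ω * (n - 1 / 2 - hi) := by ring
    have e2 : ω * (n - 1 - s.val - t.val) = -(ω * (lo + 1 / 2) - ω * (n - 1 / 2 - hi)) := by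
      have : (n : ℝ) - 1 - s.val - t.val = n - 1 - lo - hi := by linarith [hst]
      rw [this]; ring
    rw [e1, e2, Real.cosh_neg, Real.cosh_add, Real.cosh_sub]; ring
  rw [hprod]
  field_simp

end ClosedForm

end Summit.QuantumFields.YangMills.BalabanUVNodes.N15KingModelRung.TorusSpectral
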